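import Mathlib
import Literature.Computability.AlgebraicComplexity.StandardFamilies

/-!
# One-alternation algebraic KW protocols for the permanent: the generic run

Support machinery for item `stmt-ValiantsHypothesis-10302`
(`Summit.ValiantsHypothesis.ValiantsHypothesis.Theses.AlgebraicKWGames.OneAlternationLowerBound`).

We work in the polynomial ring `R n = ℂ[x_e, y_e : e ∈ Fin n × Fin n]` (Alice's variables `x = X (inl ·)`,
Bob's variables `y = X (inr ·)`).  For a finite set `E` of cells, `subst E` is the substitution
`y_e ↦ x_e (e ∈ E)`; a point `p` of `ℂ^(x,y)` *agrees on `E`* when `p (inr e) = p (inl e)` for `e ∈ E`.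

`Protocol n T` bundles the data `(blk, msg, out)` of a zero-test algebraic protocol of depth `T` for the
KW game of `per_n` in which Alice's rounds precede Bob's (`blk` monotone, `≤ 1`), together with its
correctness, all verbatim as quantified in the route statement.  `gen P E t` is the *generic message
polynomial* of round `t` on the linear subspace `{y_e = x_e, e ∈ E}`: defined by strong recursion,
branching on whether earlier generic messages are the zero polynomial.  The soundness lemma
`Protocol.generic_output_ne` says: at every point `p` agreeing on `E` at which all nonzero generic
messages are nonzero, the actual transcript is the evaluation of the generic one, so the protocol
outputs a cell where `p ∘ inl` and `p ∘ inr` differ.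

This is bookkeeping for a transcendence-degree adversary argument.  Honest framing: a lower bound in a
toy communication model (one alternation); nothing here bears on VP versus VNP.
-/

open MvPolynomial

-- the summit and the problem share the name `ValiantsHypothesis` (D-0017 single-conjunct layout)
set_option linter.dupNamespace false

namespace Summit.ValiantsHypothesis.ValiantsHypothesis.Theorems.AlgebraicKWGames.OneAlt

open scoped Classical

noncomputable section

/-- The cells of an `n × n` matrix. -/
abbrev Cell (n : ℕ) : Type := Fin n × Fin n

/-- The variables: `Sum.inl e` is Alice's `x_e`, `Sum.inr e` is Bob's `y_e`. -/
abbrev Var (n : ℕ) : Type := Cell n ⊕ Cell n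

/-- The ambient polynomial ring `ℂ[x, y]`. -/
abbrev R (n : ℕ) : Type := MvPolynomial (Var n) ℂ

variable {n : ℕ}

/-- The images of the variables under the substitution `y_e ↦ x_e (e ∈ E)`. -/
def substFun (E : Finset (Cell n)) : Var n → R n :=
  Sum.elim (fun c => X (Sum.inl c)) (fun c => if c ∈ E then X (Sum.inl c) else X (Sum.inr c))

/-- The substitution homomorphism `y_e ↦ x_e (e ∈ E)` of `ℂ[x, y]`. -/
def subst (E : Finset (Cell n)) : R n →ₐ[ℂ] R n :=
  aeval (substFun E)

/-- `subst E` fixes Alice's variables. -/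
@[simp] theorem subst_X_inl (E : Finset (Cell n)) (c : Cell n) :
    subst E (X (Sum.inl c)) = X (Sum.inl c) := by
  simp [subst, substFun]

/-- `subst E` on Bob's variables. -/
@[simp] theorem subst_X_inr (E : Finset (Cell n)) (c : Cell n) :
    subst E (X (Sum.inr c)) = if c ∈ E then X (Sum.inl c) else X (Sum.inr c) := by
  simp [subst, substFun]

/-- `subst F ∘ subst E = subst (E ∪ F)`. -/
theorem subst_comp (E F : Finset (Cell n)) :
    (subst F).comp (subst E) = subst (n := n) (E ∪ F) := by
  apply MvPolynomial.algHom_ext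
  intro v
  rcases v with c | c
  · simp
  · by_cases hE : c ∈ E
    · simp [hE]
    · by_cases hF : c ∈ F
      · simp [hE, hF]
      · simp [hE, hF]

/-- Pointwise form of `subst_comp`. -/
theorem subst_subst (E F : Finset (Cell n)) (q : R n) :
    subst F (subst E q) = subst (E ∪ F) q := by
  rw [← subst_comp]; rfl

/-- `subst E` is idempotent. -/
theorem subst_idem (E : Finset (Cell n)) (q : R n) : subst E (subst E q) = subst E q := by
  rw [subst_subst, Finset.union_idempotent]

/-- If `E ⊆ F` then `subst F ∘ subst E = subst F`. -/
theorem subst_subst_of_subset {E F : Finset (Cell n)} (h : E ⊆ F) (q : R n) :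
    subst F (subst E q) = subst F q := by
  rw [subst_subst, Finset.union_eq_right.mpr h]

/-- The point obtained from `p` by identifying `y_e` with `x_e` for `e ∈ E`. -/
def identify (E : Finset (Cell n)) (p : Var n → ℂ) : Var n → ℂ :=
  Sum.elim (fun c => p (Sum.inl c)) (fun c => if c ∈ E then p (Sum.inl c) else p (Sum.inr c))

/-- `identify E p` keeps Alice's coordinates. -/
@[simp] theorem identify_inl (E : Finset (Cell n)) (p : Var n → ℂ) (c : Cell n) :
    identify E p (Sum.inl c) = p (Sum.inl c) := rfl

/-- `identify E p` on Bob's coordinates. -/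
theorem identify_inr (E : Finset (Cell n)) (p : Var n → ℂ) (c : Cell n) :
    identify E p (Sum.inr c) = if c ∈ E then p (Sum.inl c) else p (Sum.inr c) := rfl

/-- `identify E p` agrees on `E`. -/
theorem identify_agree (E : Finset (Cell n)) (p : Var n → ℂ) {c : Cell n} (hc : c ∈ E) :
    identify E p (Sum.inr c) = identify E p (Sum.inl c) := by
  simp [identify_inr, hc]

/-- Evaluating at a point after a substitution `aeval g` is evaluating at the image point. -/
theorem eval_aeval_eq {σ τ : Type*} (p : σ → ℂ) (g : τ → MvPolynomial σ ℂ) (q : MvPolynomial τ ℂ) :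
    eval p (aeval g q) = eval (fun i => eval p (g i)) q := by
  have h : (eval p).comp (aeval g).toRingHom = eval (fun i => eval p (g i)) := by
    apply MvPolynomial.ringHom_ext
    · intro a; simp
    · intro i; simp
  exact RingHom.congr_fun h q

/-- Evaluation at `identify E p` is evaluation at `p` after `subst E`. -/
theorem eval_identify (E : Finset (Cell n)) (p : Var n → ℂ) (q : R n) :
    eval (identify E p) q = eval p (subst E q) := by
  rw [subst, eval_aeval_eq]
  have h : identify E p = fun v => eval p (substFun E v) := by
    funext v
    rcases v with c | c
    · simp [substFun, identify]
    · by_cases hc : c ∈ E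
      · simp [substFun, identify_inr, hc]
      · simp [substFun, identify_inr, hc]
  rw [h]

/-- If `p` agrees on `E`, evaluation at `p` is insensitive to `subst E`. -/
theorem eval_subst_of_agree (E : Finset (Cell n)) (p : Var n → ℂ)
    (hp : ∀ c ∈ E, p (Sum.inr c) = p (Sum.inl c)) (q : R n) :
    eval p (subst E q) = eval p q := by
  rw [← eval_identify]
  have h : identify E p = p := by
    funext v
    rcases v with c | c
    · rfl
    · by_cases hc : c ∈ E
      · simp [identify_inr, hc, hp c hc]
      · simp [identify_inr, hc]
  rw [h]

/-! ## Protocols and the generic run -/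

/-- A zero-test algebraic protocol of depth `T` for the KW game of `per_n` in which Alice speaks in the
rounds `t` with `Even (blk t)` and `blk` is monotone with values `≤ 1` (so Alice's rounds precede
Bob's), together with its correctness — the data and hypotheses quantified in the route statement
`OneAlternationLowerBound`, verbatim. -/
structure Protocol (n T : ℕ) : Type where
  /-- the block index of a round (`0` = Alice, `1` = Bob) -/
  blk : ℕ → ℕ
  /-- the message polynomial of round `t`, given the zero pattern of the earlier messages -/
  msg : (t : ℕ) → (Fin t → Bool) → MvPolynomial (Cell n ⊕ Fin t) ℂ
  /-- the output cell, given the zero pattern of the `T` messages -/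
  out : (Fin T → Bool) → Cell n
  /-- the block index is monotone -/
  mono : Monotone blk
  /-- at most one alternation -/
  le_one : ∀ t, blk t ≤ 1
  /-- correctness for the KW game of `per_n` -/
  correct : ∀ a b : Cell n → ℂ,
    MvPolynomial.eval a (Literature.Computability.AlgebraicComplexity.perPoly (Fin n) ℂ) ≠
      MvPolynomial.eval b (Literature.Computability.AlgebraicComplexity.perPoly (Fin n) ℂ) →
    ∀ (m : ℕ → ℂ) (z : ℕ → Bool), (∀ j, z j = true ↔ m j = 0) →
      (∀ t < T, m t = MvPolynomial.eval (Sum.elim (if Even (blk t) then a else b) (fun j : Fin t => m j))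
        (msg t (fun j : Fin t => z j))) →
      a (out (fun j : Fin T => z j)) ≠ b (out (fun j : Fin T => z j))

variable {T : ℕ} (P : Protocol n T)

namespace Protocol

/-- The speaker's own variables in round `t`: Alice (`Even (blk t)`) holds `x`, Bob holds `y`. -/
def vars (t : ℕ) (c : Cell n) : R n :=
  if Even (P.blk t) then X (Sum.inl c) else X (Sum.inr c)

/-- One step of the generic run on the subspace `E`: substitute the speaker's variables and the earlier
generic messages `q` into the message polynomial of round `t` (chosen by the zero pattern of `q`),
then identify `y_e` with `x_e` for `e ∈ E`. -/
def step (E : Finset (Cell n)) (t : ℕ) (q : Fin t → R n) : R n :=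
  subst E (aeval (Sum.elim (P.vars t) q) (P.msg t (fun j => decide (q j = 0))))

/-- The generic message polynomial of round `t` on the subspace `E` (strong recursion on `t`). -/
def gen (E : Finset (Cell n)) : ℕ → R n :=
  Nat.strongRec (fun t ih => P.step E t (fun j : Fin t => ih j j.2))

/-- Unfolding the strong recursion defining `gen`. -/
theorem gen_eq (E : Finset (Cell n)) (t : ℕ) :
    P.gen E t = P.step E t (fun j : Fin t => P.gen E j) := by
  rw [gen, Nat.strongRec_eq]
  rfl

/-- The generic zero pattern of round `j` on `E`. -/
def genPat (E : Finset (Cell n)) (j : ℕ) : Bool := decide (P.gen E j = 0)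

/-- Generic messages on `E` are already identified on `E`. -/
theorem subst_gen (E : Finset (Cell n)) (t : ℕ) : subst E (P.gen E t) = P.gen E t := by
  rw [gen_eq, step, subst_idem]

/-- The generic output cell on the subspace `E`. -/
def genOut (E : Finset (Cell n)) : Cell n := P.out (fun j : Fin T => P.genPat E j)

/-- **Soundness of the generic run.**  At every point `p` that agrees on `E`, at which every nonzero
generic message of a round `< T` does not vanish, and whose two halves have different permanents,
the two halves differ at the generic output cell. -/
theorem generic_output_ne (E : Finset (Cell n)) (p : Var n → ℂ)
    (hpE : ∀ c ∈ E, p (Sum.inr c) = p (Sum.inl c))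
    (hgen : ∀ t < T, P.gen E t ≠ 0 → eval p (P.gen E t) ≠ 0)
    (hper : MvPolynomial.eval (fun c => p (Sum.inl c))
        (Literature.Computability.AlgebraicComplexity.perPoly (Fin n) ℂ) ≠
      MvPolynomial.eval (fun c => p (Sum.inr c))
        (Literature.Computability.AlgebraicComplexity.perPoly (Fin n) ℂ)) :
    p (Sum.inl (P.genOut E)) ≠ p (Sum.inr (P.genOut E)) := by
  set m : ℕ → ℂ := fun t => eval p (P.gen E t) with hm
  set z : ℕ → Bool := fun j => decide (m j = 0) with hz
  -- the zero patterns agree below `T`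
  have hpat : ∀ j < T, P.genPat E j = z j := by
    intro j hj
    simp only [genPat, hz, hm]
    by_cases h0 : P.gen E j = 0
    · simp [h0]
    · have := hgen j hj h0
      simp [h0, this]
  have hzT : (fun j : Fin T => P.genPat E j) = fun j : Fin T => z j := by
    funext j; exact hpat j j.2
  have key := P.correct (fun c => p (Sum.inl c)) (fun c => p (Sum.inr c)) hper m z
    (fun j => by simp [hz]) ?_
  · simpa [genOut, hzT] using key
  intro t ht
  have hzt : (fun j : Fin t => z j) = fun j : Fin t => P.genPat E j := by
    funext j; exact (hpat j (lt_trans j.2 ht)).symm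
  rw [hzt]
  show eval p (P.gen E t) = _
  rw [gen_eq, step, eval_subst_of_agree E p hpE, eval_aeval_eq]
  have hfun : (fun i => eval p (Sum.elim (P.vars t) (fun j : Fin t => P.gen E j) i)) =
      Sum.elim (if Even (P.blk t) then (fun c => p (Sum.inl c)) else fun c => p (Sum.inr c))
        (fun j : Fin t => m j) := by
    funext i
    rcases i with c | j
    · simp only [Sum.elim_inl, vars]
      split_ifs <;> simp
    · simp [hm]
  rw [hfun]
  rfl

end Protocol

end

end Summit.ValiantsHypothesis.ValiantsHypothesis.Theorems.AlgebraicKWGames.OneAlt
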